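import Summits.QuantumFields.BalabanUV.Beta.ResolventLeafRecord
import Summits.QuantumFields.BalabanUV.Beta.CapRowsQhalf

/-!
# Beta / CapRouteARealBall — THE (T) BINDER IN THE ENGINES' CURRENCY for the certificate-currency anchors: the chain's (Z2) conclusion
# `StripRegularC G κ M_a` EXPOSED, and route A's anchor over (schedule, records) with the two-engine ball as a REAL ∕ PAIRED (QHALF) ball
# (β sub-cell, BINDER-OWNERS row CAP-k, lineage `b2b-balaban-beta-an5`, gen 26; node BETA-an5-g26-SCHEDULES, leaf 5; journal l.17735 ∕ l.18274)

Every certificate-currency anchor of the row (`CapRouteABoxes…` p221641 → `…Reflect` p222823 → `…Fins` p225736 → `…Schedules` p228158 →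
`…Records` p228449) takes the (T) binder as the COMPLEX ball `‖|S_E|⁻¹ Σ_{w ∈ S_E} g(w) − t‖ ≤ r` over the full code16 node set.  What two
engines certify (CERT row 8 at `N = 4`: 2 056 QHALF representatives of 4 096 nodes; any `N = 9` campaign per CAP-KERNEL §4.23 (e)) is a REAL
ball for the mean of `Re g` over a PAIRED sum `Σ_{S₀} Re g + 2·Σ_R Re g` (`S_E = S₀ ∪ R ∪ (−R)`).  The bridge (`CapRowsQhalf.ball_of_real_ball`,
`sum_re_pairing`) needs strip regularity of `g` and the reality `g(−p) = conj g(p)`; in the certificate chain the regularity is DERIVED deep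
inside the anchors.  THIS LEAF exposes it and re-issues the END in the engines' currency:

* §1 **`stripRegularC_routeA_ofFinRects`** — from exactly the binders of `CapRouteAFins.…_ofReflect_ofFinRects` minus (N)(T)(A)(cmp):
  `StripRegularC g κ (|n|·(Ba·S_st + Ba·S_s·Ba·S_t))` — THE (Z2) CONCLUSION OF THE ROW'S CHAIN AS A NAMED THEOREM (boxes ⟹ (F) + `hBa` by the
  symmetry transports; fins + `hR` ⟹ (W); THEOREM DB ⟹ (Z1) on the tube; real shift ⟹ the primed data; route A's master bound);
  **`stripRegularC_routeA_ofRecords`** — the same over (rational-root schedule, records, fin schedules);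
* §2 **`rowsOfOneLoopFormCode16E_routeA₂_ofRecords_ofRealBall`** — `ResolventLeafRecord.…_ofRecords` with `hT` REPLACED by the REAL ball
  `|(|S_E|⁻¹·Σ_{S_E} Re g) − t| ≤ r` + the reality `hsym` of `g` on real momenta (hypothesis);
* §3 ZERO SHIFT (`c = 0`, the bubble at zero external momentum): `hsym` DISCHARGED from `MatConjSymm` of `A, B, C, D`
  (`ConjReflectionAlgebra.oneLoopForm_hsym`) — **`…_ofRecords_ofRealBall₀`**; for a real shift `c ≠ 0` the form is NOT `q ↦ −q̄`-symmetric
  (`ConjReflectionAlgebra`, module doc CAVEAT), so no discharge is claimed there;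
* §4 **`…_ofRecords_ofPairedBall₀`** — the (T) binder LITERALLY as the engines' object: a real ball for `|S_E|⁻¹·(Σ_{S₀} Re g + 2·Σ_R Re g)`
  with the decidable pairing data `S_E = S₀ ∪ R ∪ (−R)` (pairwise disjoint); `k₀ = 0`, `lo 0 = lo` (`CapRowsQhalf.rowsOfCode16E_ofRealBall_consts`).

HONEST FRAMING.  Kernel glue over the tree's QHALF lemmas and the gen-23–26 anchors; no node set partition, no ball, no number supplied;
0 binders instantiated; 0 certified coefficients; CERT row 8's `N = 4` ball is NOT usable with route A's `M_a` (budget floor `N = 9`,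
CAP-KERNEL §4.23) — this leaf changes the SHAPE in which a future ball plugs in, not its price.  Discharging `BetaPertH` would make Bałaban's
ultraviolet stability unconditional — NOT the continuum limit, NOT the Clay problem.  0 `sorry`, 0 cite tags.
-/

namespace Summit.QuantumFields.BalabanUV.Beta.CapRouteARealBall

open Complex Set Matrix
open Literature.MathematicalPhysics.QuantumFieldTheory.Balaban1983to89
open B4Strip (Strip ofRealVec)
open B4ContourShift (latticeKernel StripRegular)
open B4TorusKernel (descend gridPt)
open Beta.AliasingTailL1 (aliasRatioL1 StripRegularC)
open Beta.AliasingTailLattice (codeTheta code16SetE)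
open Summit.QuantumFields.BalabanUV.Beta.CapRows (Rows)
open Summit.QuantumFields.BalabanUV.Beta.TubeMaximumModulus
open Summit.QuantumFields.BalabanUV.Beta.VertexToriSymmetry
open Summit.QuantumFields.BalabanUV.Beta.ConjReflectionAlgebra (MatConjSymm oneLoopForm_hsym)
open Summit.QuantumFields.BalabanUV.Beta.ResolventBoxCertificate (Box hBa_of_boxes_negConjRegion)
open Summit.QuantumFields.BalabanUV.Beta.ResolventFinCertificate (of_fin_cover)
open Summit.QuantumFields.BalabanUV.Beta.TubeZeroFreeEnds
open Summit.QuantumFields.BalabanUV.Beta.TubeZeroFreeSymmetry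
open Summit.QuantumFields.BalabanUV.Beta.CapRouteA (stripRegularC_oneLoopForm_routeA₂)
open Summit.QuantumFields.BalabanUV.Beta.CapRouteABoxes (invNorm_sub_real_le_of_vertexTori)
open Summit.QuantumFields.BalabanUV.Beta.CapRouteABoxesReflect (windingHyp_of_reflect_const)
open Summit.QuantumFields.BalabanUV.Beta.CapRowsQhalf (rowsOfCode16E_ofRealBall neg_mem_code16SetE sum_re_pairing)
open Summit.QuantumFields.BalabanUV.Beta.CoverSchedules
open Summit.QuantumFields.BalabanUV.Beta.ResolventLeafRecord (BlockLeafRecord quarterBoxesQ hcov_of_schedulesQ hcert_of_records)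
open scoped Real ComplexConjugate Matrix.Norms.L2Operator

noncomputable section

variable {n : Type*} [Fintype n] [DecidableEq n]

/-! ## §1 The chain's (Z2) conclusion, exposed -/

section StripRegular

variable {A B C D : (Fin 4 → ℂ) → Matrix n n ℂ} {κ Ba Sst Ss St : ℝ} {c : Fin 4 → ℂ}

/-- **THE (Z2) CONCLUSION OF THE ROW'S CERTIFICATE CHAIN, BY NAME**: STRUCTURE + `MatNegTranspose` + `MatConjSymm` + ONE quarter-region box cover
with per-leaf `IsUnit (A q).det ∧ ‖(A q)⁻¹‖ ≤ Ba` + `hR` + FOUR fin-rectangle covers with per-leaf `IsUnit (A p).det` + the three stencil sups ⟹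
`StripRegularC g κ (|n|·(Ba·S_st + Ba·S_s·Ba·S_t))` for the one-loop form `g` with the real-shifted second resolvent (exactly the derivation
inside `CapRouteAFins.…_ofReflect_ofFinRects`, now a theorem of its own). [folklore] -/
theorem stripRegularC_routeA_ofFinRects (hκ : 0 < κ) (hc : ∀ μ, (c μ).im = 0)
    (hA : MatTubeHol A (fun _ => κ)) (hA' : MatTubeHol (fun p => A (p - c)) (fun _ => κ))
    (hBst : MatTubeHol B (fun _ => κ)) (hBs : MatTubeHol C (fun _ => κ)) (hBt : MatTubeHol D (fun _ => κ))
    (hAn : MatNegTranspose A) (hAc : MatConjSymm A)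
    (ν₀ ν₁ : Fin (3 + 1)) {ι : Type*} (boxes : Finset ι) (ctr : ι → Fin (3 + 1) → ℂ) (hw : ι → Fin (3 + 1) → ℝ)
    (hcov : ∀ q ∈ VertexTori (fun _ : Fin (3 + 1) => κ), (q ν₀).im = κ → (q ν₁).re ≤ 0 → ∃ bx ∈ boxes, q ∈ Box (ctr bx) (hw bx))
    (hcert : ∀ bx ∈ boxes, ∀ q ∈ Box (ctr bx) (hw bx), IsUnit (A q).det ∧ ‖(A q)⁻¹‖ ≤ Ba)
    (hR : ∀ (ν : Fin (3 + 1)) (p : Fin (3 + 1) → ℂ), (A (reflectAt ν p)).det = (A p).det)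
    {ι' : Type*} (rects : Fin (3 + 1) → Finset ι') (τc xc hτ hx : Fin (3 + 1) → ι' → ℝ)
    (hcovF : ∀ (i : Fin (3 + 1)), ∀ τ ∈ Icc (0 : ℝ) 1, ∀ x ∈ Icc (-π) π,
      ∃ bx ∈ rects i, |τ - τc i bx| ≤ hτ i bx ∧ |x - xc i bx| ≤ hx i bx)
    (hcertF : ∀ (i : Fin (3 + 1)), ∀ bx ∈ rects i, ∀ τ x : ℝ, |τ - τc i bx| ≤ hτ i bx → |x - xc i bx| ≤ hx i bx →
      IsUnit (A (i.insertNth ((x : ℂ) + ((τ * κ : ℝ) : ℂ) * I) fun _ => ((τ * κ : ℝ) : ℂ) * I)).det)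
    (hSst : ∀ p ∈ VertexTori (fun _ : Fin (3 + 1) => κ), ‖B p‖ ≤ Sst)
    (hSs : ∀ p ∈ VertexTori (fun _ : Fin (3 + 1) => κ), ‖C p‖ ≤ Ss)
    (hSt : ∀ p ∈ VertexTori (fun _ : Fin (3 + 1) => κ), ‖D p‖ ≤ St) :
    StripRegularC (fun p => ((A p)⁻¹ * B p).trace - ((A p)⁻¹ * C p * (A (p - c))⁻¹ * D p).trace) κ
      (Fintype.card n * (Ba * Sst + Ba * Ss * Ba * St)) := by
  have hF : ∀ q ∈ VertexTori (fun _ : Fin (3 + 1) => κ), (A q).det ≠ 0 :=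
    det_ne_zero_vertexTori_of_boxes_negConjRegion hAn hAc ν₀ ν₁ boxes ctr hw hcov hcert
  have hBa : ∀ p ∈ VertexTori (fun _ : Fin (3 + 1) => κ), ‖(A p)⁻¹‖ ≤ Ba :=
    hBa_of_boxes_negConjRegion hAn hAc ν₀ ν₁ boxes ctr hw hcov hcert
  have hW4 : ∀ i : Fin (3 + 1), SliceWindingEq (fun p => (A p).det) (fun _ => κ) i fun _ => ((κ : ℝ) : ℂ) * I :=
    fun i => sliceWindingEq_allPlus_of_fin hA.det i (fun _ => hκ.le) (hR i) fun τ hτ' x hx' =>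
      (of_fin_cover (rects i) (τc i) (xc i) (hτ i) (hx i) (hcovF i) (hcertF i) τ hτ' x hx').ne_zero
  have hW := windingHyp_of_reflect_const (G := fun p => (A p).det) hR hW4
  exact stripRegularC_oneLoopForm_routeA₂ (A' := fun p => A (p - c)) le_rfl hA hA' hBst hBs hBt
    (MatTubeHol.det_ne_zero_of_vertexTori hA hκ hF hW)
    (det_sub_ne_zero_of_tube (MatTubeHol.det_ne_zero_tube_of_vertexTori hA hκ hF hW) hc)
    hBa (invNorm_sub_real_le_of_vertexTori hA hBa hc) hSst hSs hSt

variable {v u : Type*} [Fintype v] [Fintype u] [DecidableEq v] [DecidableEq u]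

/-- **THE SAME OVER (RATIONAL-ROOT SCHEDULE, RECORDS, FIN SCHEDULES)**: the (Z2) conclusion from exactly the binders of
`ResolventLeafRecord.rowsOfOneLoopFormCode16E_routeA₂_ofRecords` minus (N)(T)(A)(cmp). [folklore] -/
theorem stripRegularC_routeA_ofRecords (hκ : 0 < κ) (hc : ∀ μ, (c μ).im = 0)
    (hA : MatTubeHol A (fun _ => κ)) (hA' : MatTubeHol (fun p => A (p - c)) (fun _ => κ))
    (hBst : MatTubeHol B (fun _ => κ)) (hBs : MatTubeHol C (fun _ => κ)) (hBt : MatTubeHol D (fun _ => κ))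
    (hAn : MatNegTranspose A) (hAc : MatConjSymm A)
    {R : ℚ} (hRπ : π ≤ (R : ℝ)) (ν₀ ν₁ : Fin (3 + 1)) (S : (Fin (3 + 1) → Bool) → Sched 3)
    (rec : (Fin (3 + 1) → ℂ) × (Fin (3 + 1) → ℝ) → BlockLeafRecord 3)
    (hvalid : ∀ bx ∈ quarterBoxesQ (fun _ : Fin (3 + 1) => κ) R ν₀ ν₁ S, (rec bx).Valid ∧ ((rec bx).B : ℝ) ≤ Ba)
    (hsub : ∀ bx ∈ quarterBoxesQ (fun _ : Fin (3 + 1) => κ) R ν₀ ν₁ S, Box bx.1 bx.2 ⊆ (rec bx).box)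
    (e : v ⊕ u ≃ n) (G : (Fin (3 + 1) → ℂ) → Matrix v v ℂ) (X : (Fin (3 + 1) → ℂ) → Matrix v u ℂ)
    (Y : (Fin (3 + 1) → ℂ) → Matrix u v ℂ) (Z : (Fin (3 + 1) → ℂ) → Matrix u u ℂ)
    (hG : ∀ bx ∈ quarterBoxesQ (fun _ : Fin (3 + 1) => κ) R ν₀ ν₁ S, ∀ q ∈ (rec bx).box,
      (A q).submatrix e e * fromBlocks (G q) (X q) (Y q) (Z q) = 1)
    (hsup : ∀ bx ∈ quarterBoxesQ (fun _ : Fin (3 + 1) => κ) R ν₀ ν₁ S,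
      (∀ q ∈ (rec bx).box, ‖G q‖ ≤ (rec bx).a) ∧ (∀ q ∈ (rec bx).box, ‖X q‖ ≤ (rec bx).b) ∧
      (∀ q ∈ (rec bx).box, ‖Y q‖ ≤ (rec bx).c') ∧ (∀ q ∈ (rec bx).box, ‖Z q‖ ≤ (rec bx).e'))
    (hRfl : ∀ (ν : Fin (3 + 1)) (p : Fin (3 + 1) → ℂ), (A (reflectAt ν p)).det = (A p).det)
    (F : Fin (3 + 1) → Sched 1)
    (hcertF : ∀ (i : Fin (3 + 1)), ∀ bx ∈ finRects (F i), ∀ τ x : ℝ, |τ - bx.1 0| ≤ bx.2 0 → |x - bx.1 1| ≤ bx.2 1 →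
      IsUnit (A (i.insertNth ((x : ℂ) + ((τ * κ : ℝ) : ℂ) * I) fun _ => ((τ * κ : ℝ) : ℂ) * I)).det)
    (hSst : ∀ p ∈ VertexTori (fun _ : Fin (3 + 1) => κ), ‖B p‖ ≤ Sst)
    (hSs : ∀ p ∈ VertexTori (fun _ : Fin (3 + 1) => κ), ‖C p‖ ≤ Ss)
    (hSt : ∀ p ∈ VertexTori (fun _ : Fin (3 + 1) => κ), ‖D p‖ ≤ St) :
    StripRegularC (fun p => ((A p)⁻¹ * B p).trace - ((A p)⁻¹ * C p * (A (p - c))⁻¹ * D p).trace) κ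
      (Fintype.card n * (Ba * Sst + Ba * Ss * Ba * St)) :=
  stripRegularC_routeA_ofFinRects hκ hc hA hA' hBst hBs hBt hAn hAc ν₀ ν₁ (quarterBoxesQ (fun _ : Fin (3 + 1) => κ) R ν₀ ν₁ S)
    Prod.fst Prod.snd (hcov_of_schedulesQ _ hRπ ν₀ ν₁ S) (hcert_of_records rec hvalid hsub e G X Y Z hG hsup) hRfl
    (fun i => finRects (F i)) (fun _ bx => bx.1 0) (fun _ bx => bx.1 1) (fun _ bx => bx.2 0) (fun _ bx => bx.2 1)
    (hcovF_of_schedules F) hcertF hSst hSs hSt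

end StripRegular

/-! ## §2 The anchor over records with a REAL ball and the reality hypothesis -/

section RealBall

variable {b : ℕ → ℝ} {A B C D : (Fin 4 → ℂ) → Matrix n n ℂ} {κ Ba Sst Ss St : ℝ} {c : Fin 4 → ℂ}
variable {v u : Type*} [Fintype v] [Fintype u] [DecidableEq v] [DecidableEq u]

/-- **ROUTE A OVER (SCHEDULE, RECORDS) WITH A REAL BALL**: `ResolventLeafRecord.rowsOfOneLoopFormCode16E_routeA₂_ofRecords` with the complex
ball `hT` REPLACED by the real ball `hTre : |(|S_E|⁻¹·Σ_{S_E} Re g) − t| ≤ r` and the reality `hsym : g(−p) = conj g(p)` on real momenta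
(dischargeable for `c = 0`, §3).  `k₀ = 0`, `lo 0 = lo`. [folklore] -/
def rowsOfOneLoopFormCode16E_routeA₂_ofRecords_ofRealBall
    (hb : b 0 = (latticeKernel (fun p => ((A p)⁻¹ * B p).trace - ((A p)⁻¹ * C p * (A (p - c))⁻¹ * D p).trace) 0).re)
    (hκ : 0 < κ) (hc : ∀ μ, (c μ).im = 0)
    (hA : MatTubeHol A (fun _ => κ)) (hA' : MatTubeHol (fun p => A (p - c)) (fun _ => κ))
    (hBst : MatTubeHol B (fun _ => κ)) (hBs : MatTubeHol C (fun _ => κ)) (hBt : MatTubeHol D (fun _ => κ))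
    (hAn : MatNegTranspose A) (hAc : MatConjSymm A)
    (hsym : ∀ p : Fin 4 → ℝ,
      (((A (ofRealVec (-p)))⁻¹ * B (ofRealVec (-p))).trace
          - ((A (ofRealVec (-p)))⁻¹ * C (ofRealVec (-p)) * (A (ofRealVec (-p) - c))⁻¹ * D (ofRealVec (-p))).trace)
        = conj ((((A (ofRealVec p))⁻¹ * B (ofRealVec p)).trace
          - ((A (ofRealVec p))⁻¹ * C (ofRealVec p) * (A (ofRealVec p - c))⁻¹ * D (ofRealVec p)).trace)))
    {R : ℚ} (hRπ : π ≤ (R : ℝ)) (ν₀ ν₁ : Fin (3 + 1)) (S : (Fin (3 + 1) → Bool) → Sched 3)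
    (rec : (Fin (3 + 1) → ℂ) × (Fin (3 + 1) → ℝ) → BlockLeafRecord 3)
    (hvalid : ∀ bx ∈ quarterBoxesQ (fun _ : Fin (3 + 1) => κ) R ν₀ ν₁ S, (rec bx).Valid ∧ ((rec bx).B : ℝ) ≤ Ba)
    (hsub : ∀ bx ∈ quarterBoxesQ (fun _ : Fin (3 + 1) => κ) R ν₀ ν₁ S, Box bx.1 bx.2 ⊆ (rec bx).box)
    (e : v ⊕ u ≃ n) (G : (Fin (3 + 1) → ℂ) → Matrix v v ℂ) (X : (Fin (3 + 1) → ℂ) → Matrix v u ℂ)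
    (Y : (Fin (3 + 1) → ℂ) → Matrix u v ℂ) (Z : (Fin (3 + 1) → ℂ) → Matrix u u ℂ)
    (hG : ∀ bx ∈ quarterBoxesQ (fun _ : Fin (3 + 1) => κ) R ν₀ ν₁ S, ∀ q ∈ (rec bx).box,
      (A q).submatrix e e * fromBlocks (G q) (X q) (Y q) (Z q) = 1)
    (hsup : ∀ bx ∈ quarterBoxesQ (fun _ : Fin (3 + 1) => κ) R ν₀ ν₁ S,
      (∀ q ∈ (rec bx).box, ‖G q‖ ≤ (rec bx).a) ∧ (∀ q ∈ (rec bx).box, ‖X q‖ ≤ (rec bx).b) ∧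
      (∀ q ∈ (rec bx).box, ‖Y q‖ ≤ (rec bx).c') ∧ (∀ q ∈ (rec bx).box, ‖Z q‖ ≤ (rec bx).e'))
    (hRfl : ∀ (ν : Fin (3 + 1)) (p : Fin (3 + 1) → ℂ), (A (reflectAt ν p)).det = (A p).det)
    (F : Fin (3 + 1) → Sched 1)
    (hcertF : ∀ (i : Fin (3 + 1)), ∀ bx ∈ finRects (F i), ∀ τ x : ℝ, |τ - bx.1 0| ≤ bx.2 0 → |x - bx.1 1| ≤ bx.2 1 →
      IsUnit (A (i.insertNth ((x : ℂ) + ((τ * κ : ℝ) : ℂ) * I) fun _ => ((τ * κ : ℝ) : ℂ) * I)).det)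
    (hSst : ∀ p ∈ VertexTori (fun _ : Fin (3 + 1) => κ), ‖B p‖ ≤ Sst)
    (hSs : ∀ p ∈ VertexTori (fun _ : Fin (3 + 1) => κ), ‖C p‖ ≤ Ss)
    (hSt : ∀ p ∈ VertexTori (fun _ : Fin (3 + 1) => κ), ‖D p‖ ≤ St)
    {N : ℕ} (hN : 1 ≤ N) [NeZero (4 * N)] {t r : ℝ}
    (hTre : |((code16SetE N).card : ℝ)⁻¹ *
        (∑ w ∈ code16SetE N, (descend (fun p => ((A p)⁻¹ * B p).trace - ((A p)⁻¹ * C p * (A (p - c))⁻¹ * D p).trace)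
          (gridPt (4 * N) w)).re) - t| ≤ r)
    {A₀ : ℝ} (hA₀ : Fintype.card n * (Ba * Sst + Ba * Ss * Ba * St) * codeTheta (aliasRatioL1 κ N) ≤ A₀) (lo : ℚ)
    (hlo : ((lo : ℚ) : ℝ) ≤ t - r - A₀) : Rows b :=
  rowsOfCode16E_ofRealBall hb
    (stripRegularC_routeA_ofRecords hκ hc hA hA' hBst hBs hBt hAn hAc hRπ ν₀ ν₁ S rec hvalid hsub e G X Y Z hG hsup hRfl F hcertF
      hSst hSs hSt) hκ hsym hN hTre hA₀ lo hlo

end RealBall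

/-! ## §3 Zero shift: the reality of the node values discharged from `MatConjSymm` -/

section ZeroShift

variable {b : ℕ → ℝ} {A B C D : (Fin 4 → ℂ) → Matrix n n ℂ} {κ Ba Sst Ss St : ℝ}
variable {v u : Type*} [Fintype v] [Fintype u] [DecidableEq v] [DecidableEq u]

/-- at zero shift the one-loop form with `MatConjSymm` families is `q ↦ −q̄`-symmetric on real momenta (`oneLoopForm_hsym`). [folklore] -/
theorem hsym_zeroShift (hAc : MatConjSymm A) (rB : MatConjSymm B) (rC : MatConjSymm C) (rD : MatConjSymm D) :
    ∀ p : Fin 4 → ℝ,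
      (((A (ofRealVec (-p)))⁻¹ * B (ofRealVec (-p))).trace
          - ((A (ofRealVec (-p)))⁻¹ * C (ofRealVec (-p)) * (A (ofRealVec (-p) - 0))⁻¹ * D (ofRealVec (-p))).trace)
        = conj ((((A (ofRealVec p))⁻¹ * B (ofRealVec p)).trace
          - ((A (ofRealVec p))⁻¹ * C (ofRealVec p) * (A (ofRealVec p - 0))⁻¹ * D (ofRealVec p)).trace)) := by
  have hA0 : MatConjSymm (fun q : Fin 4 → ℂ => A (q - 0)) := fun q => by simpa only [sub_zero] using hAc q
  exact oneLoopForm_hsym (A' := fun q => A (q - 0)) hAc hA0 rB rC rD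

/-- **ROUTE A OVER (SCHEDULE, RECORDS) WITH A REAL BALL, ZERO SHIFT** — the bubble at zero external momentum (`c = 0`): REALITY `MatConjSymm` of
`A, B, C, D` discharges `hsym`; the (T) binder is the real ball `hTre` alone. [folklore] -/
def rowsOfOneLoopFormCode16E_routeA₂_ofRecords_ofRealBall₀
    (hb : b 0 = (latticeKernel (fun p => ((A p)⁻¹ * B p).trace - ((A p)⁻¹ * C p * (A (p - 0))⁻¹ * D p).trace) 0).re)
    (hκ : 0 < κ) (hA : MatTubeHol A (fun _ => κ))
    (hBst : MatTubeHol B (fun _ => κ)) (hBs : MatTubeHol C (fun _ => κ)) (hBt : MatTubeHol D (fun _ => κ))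
    (hAn : MatNegTranspose A) (hAc : MatConjSymm A) (rB : MatConjSymm B) (rC : MatConjSymm C) (rD : MatConjSymm D)
    {R : ℚ} (hRπ : π ≤ (R : ℝ)) (ν₀ ν₁ : Fin (3 + 1)) (S : (Fin (3 + 1) → Bool) → Sched 3)
    (rec : (Fin (3 + 1) → ℂ) × (Fin (3 + 1) → ℝ) → BlockLeafRecord 3)
    (hvalid : ∀ bx ∈ quarterBoxesQ (fun _ : Fin (3 + 1) => κ) R ν₀ ν₁ S, (rec bx).Valid ∧ ((rec bx).B : ℝ) ≤ Ba)
    (hsub : ∀ bx ∈ quarterBoxesQ (fun _ : Fin (3 + 1) => κ) R ν₀ ν₁ S, Box bx.1 bx.2 ⊆ (rec bx).box)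
    (e : v ⊕ u ≃ n) (G : (Fin (3 + 1) → ℂ) → Matrix v v ℂ) (X : (Fin (3 + 1) → ℂ) → Matrix v u ℂ)
    (Y : (Fin (3 + 1) → ℂ) → Matrix u v ℂ) (Z : (Fin (3 + 1) → ℂ) → Matrix u u ℂ)
    (hG : ∀ bx ∈ quarterBoxesQ (fun _ : Fin (3 + 1) => κ) R ν₀ ν₁ S, ∀ q ∈ (rec bx).box,
      (A q).submatrix e e * fromBlocks (G q) (X q) (Y q) (Z q) = 1)
    (hsup : ∀ bx ∈ quarterBoxesQ (fun _ : Fin (3 + 1) => κ) R ν₀ ν₁ S,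
      (∀ q ∈ (rec bx).box, ‖G q‖ ≤ (rec bx).a) ∧ (∀ q ∈ (rec bx).box, ‖X q‖ ≤ (rec bx).b) ∧
      (∀ q ∈ (rec bx).box, ‖Y q‖ ≤ (rec bx).c') ∧ (∀ q ∈ (rec bx).box, ‖Z q‖ ≤ (rec bx).e'))
    (hRfl : ∀ (ν : Fin (3 + 1)) (p : Fin (3 + 1) → ℂ), (A (reflectAt ν p)).det = (A p).det)
    (F : Fin (3 + 1) → Sched 1)
    (hcertF : ∀ (i : Fin (3 + 1)), ∀ bx ∈ finRects (F i), ∀ τ x : ℝ, |τ - bx.1 0| ≤ bx.2 0 → |x - bx.1 1| ≤ bx.2 1 →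
      IsUnit (A (i.insertNth ((x : ℂ) + ((τ * κ : ℝ) : ℂ) * I) fun _ => ((τ * κ : ℝ) : ℂ) * I)).det)
    (hSst : ∀ p ∈ VertexTori (fun _ : Fin (3 + 1) => κ), ‖B p‖ ≤ Sst)
    (hSs : ∀ p ∈ VertexTori (fun _ : Fin (3 + 1) => κ), ‖C p‖ ≤ Ss)
    (hSt : ∀ p ∈ VertexTori (fun _ : Fin (3 + 1) => κ), ‖D p‖ ≤ St)
    {N : ℕ} (hN : 1 ≤ N) [NeZero (4 * N)] {t r : ℝ}
    (hTre : |((code16SetE N).card : ℝ)⁻¹ *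
        (∑ w ∈ code16SetE N, (descend (fun p => ((A p)⁻¹ * B p).trace - ((A p)⁻¹ * C p * (A (p - 0))⁻¹ * D p).trace)
          (gridPt (4 * N) w)).re) - t| ≤ r)
    {A₀ : ℝ} (hA₀ : Fintype.card n * (Ba * Sst + Ba * Ss * Ba * St) * codeTheta (aliasRatioL1 κ N) ≤ A₀) (lo : ℚ)
    (hlo : ((lo : ℚ) : ℝ) ≤ t - r - A₀) : Rows b :=
  rowsOfOneLoopFormCode16E_routeA₂_ofRecords_ofRealBall hb hκ (fun _ => by simp) hA (by simpa only [sub_zero] using hA) hBst hBs hBt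
    hAn hAc (hsym_zeroShift hAc rB rC rD) hRπ ν₀ ν₁ S rec hvalid hsub e G X Y Z hG hsup hRfl F hcertF hSst hSs hSt hN hTre hA₀ lo hlo

/-! ## §4 … and with the PAIRED (QHALF) ball — the engines' literal (T) object -/

/-- **ROUTE A OVER (SCHEDULE, RECORDS) WITH THE PAIRED BALL, ZERO SHIFT**: the (T) binder LITERALLY as two engines certify it — a real ball for
`|S_E|⁻¹·(Σ_{w ∈ S₀} Re g(w) + 2·Σ_{w ∈ R} Re g(w))` together with the DECIDABLE pairing data `S_E = S₀ ∪ R ∪ (−R)` (pairwise disjoint; `S₀` the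
self-conjugate nodes, `R` one node per pair — CERT row 8's «2 056 QHALF reps» at `N = 4`). [folklore] -/
def rowsOfOneLoopFormCode16E_routeA₂_ofRecords_ofPairedBall₀
    (hb : b 0 = (latticeKernel (fun p => ((A p)⁻¹ * B p).trace - ((A p)⁻¹ * C p * (A (p - 0))⁻¹ * D p).trace) 0).re)
    (hκ : 0 < κ) (hA : MatTubeHol A (fun _ => κ))
    (hBst : MatTubeHol B (fun _ => κ)) (hBs : MatTubeHol C (fun _ => κ)) (hBt : MatTubeHol D (fun _ => κ))
    (hAn : MatNegTranspose A) (hAc : MatConjSymm A) (rB : MatConjSymm B) (rC : MatConjSymm C) (rD : MatConjSymm D)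
    {R : ℚ} (hRπ : π ≤ (R : ℝ)) (ν₀ ν₁ : Fin (3 + 1)) (S : (Fin (3 + 1) → Bool) → Sched 3)
    (rec : (Fin (3 + 1) → ℂ) × (Fin (3 + 1) → ℝ) → BlockLeafRecord 3)
    (hvalid : ∀ bx ∈ quarterBoxesQ (fun _ : Fin (3 + 1) => κ) R ν₀ ν₁ S, (rec bx).Valid ∧ ((rec bx).B : ℝ) ≤ Ba)
    (hsub : ∀ bx ∈ quarterBoxesQ (fun _ : Fin (3 + 1) => κ) R ν₀ ν₁ S, Box bx.1 bx.2 ⊆ (rec bx).box)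
    (e : v ⊕ u ≃ n) (G : (Fin (3 + 1) → ℂ) → Matrix v v ℂ) (X : (Fin (3 + 1) → ℂ) → Matrix v u ℂ)
    (Y : (Fin (3 + 1) → ℂ) → Matrix u v ℂ) (Z : (Fin (3 + 1) → ℂ) → Matrix u u ℂ)
    (hG : ∀ bx ∈ quarterBoxesQ (fun _ : Fin (3 + 1) => κ) R ν₀ ν₁ S, ∀ q ∈ (rec bx).box,
      (A q).submatrix e e * fromBlocks (G q) (X q) (Y q) (Z q) = 1)
    (hsup : ∀ bx ∈ quarterBoxesQ (fun _ : Fin (3 + 1) => κ) R ν₀ ν₁ S,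
      (∀ q ∈ (rec bx).box, ‖G q‖ ≤ (rec bx).a) ∧ (∀ q ∈ (rec bx).box, ‖X q‖ ≤ (rec bx).b) ∧
      (∀ q ∈ (rec bx).box, ‖Y q‖ ≤ (rec bx).c') ∧ (∀ q ∈ (rec bx).box, ‖Z q‖ ≤ (rec bx).e'))
    (hRfl : ∀ (ν : Fin (3 + 1)) (p : Fin (3 + 1) → ℂ), (A (reflectAt ν p)).det = (A p).det)
    (F : Fin (3 + 1) → Sched 1)
    (hcertF : ∀ (i : Fin (3 + 1)), ∀ bx ∈ finRects (F i), ∀ τ x : ℝ, |τ - bx.1 0| ≤ bx.2 0 → |x - bx.1 1| ≤ bx.2 1 →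
      IsUnit (A (i.insertNth ((x : ℂ) + ((τ * κ : ℝ) : ℂ) * I) fun _ => ((τ * κ : ℝ) : ℂ) * I)).det)
    (hSst : ∀ p ∈ VertexTori (fun _ : Fin (3 + 1) => κ), ‖B p‖ ≤ Sst)
    (hSs : ∀ p ∈ VertexTori (fun _ : Fin (3 + 1) => κ), ‖C p‖ ≤ Ss)
    (hSt : ∀ p ∈ VertexTori (fun _ : Fin (3 + 1) => κ), ‖D p‖ ≤ St)
    {N : ℕ} (hN : 1 ≤ N) [NeZero (4 * N)] (S₀ Rp : Finset (Fin (3 + 1) → Fin (4 * N)))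
    (hdec : code16SetE N = S₀ ∪ Rp ∪ Rp.image (fun w => -w)) (hd₁ : Disjoint S₀ Rp)
    (hd₂ : Disjoint S₀ (Rp.image fun w => -w)) (hd₃ : Disjoint Rp (Rp.image fun w => -w)) {t r : ℝ}
    (hTpair : |((code16SetE N).card : ℝ)⁻¹ *
        (∑ w ∈ S₀, (descend (fun p => ((A p)⁻¹ * B p).trace - ((A p)⁻¹ * C p * (A (p - 0))⁻¹ * D p).trace)
            (gridPt (4 * N) w)).re
          + 2 * ∑ w ∈ Rp, (descend (fun p => ((A p)⁻¹ * B p).trace - ((A p)⁻¹ * C p * (A (p - 0))⁻¹ * D p).trace)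
            (gridPt (4 * N) w)).re) - t| ≤ r)
    {A₀ : ℝ} (hA₀ : Fintype.card n * (Ba * Sst + Ba * Ss * Ba * St) * codeTheta (aliasRatioL1 κ N) ≤ A₀) (lo : ℚ)
    (hlo : ((lo : ℚ) : ℝ) ≤ t - r - A₀) : Rows b :=
  have hreg := stripRegularC_routeA_ofRecords (c := 0) hκ (fun _ => by simp) hA (by simpa only [sub_zero] using hA) hBst hBs hBt
    hAn hAc hRπ ν₀ ν₁ S rec hvalid hsub e G X Y Z hG hsup hRfl F hcertF hSst hSs hSt
  rowsOfOneLoopFormCode16E_routeA₂_ofRecords_ofRealBall₀ hb hκ hA hBst hBs hBt hAn hAc rB rC rD hRπ ν₀ ν₁ S rec hvalid hsub e G X Y Z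
    hG hsup hRfl F hcertF hSst hSs hSt hN
    (t := t) (r := r) (by
      rw [sum_re_pairing (hreg.toStripRegular hκ.le) hκ.le (hsym_zeroShift hAc rB rC rD) S₀ Rp hdec hd₁ hd₂ hd₃]
      exact hTpair)
    hA₀ lo hlo

end ZeroShift

end

end Summit.QuantumFields.BalabanUV.Beta.CapRouteARealBall
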